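/-
Copyright (c) 2026 the pub-hodgecm-mathlib formalisation cell (harness21).  Prover seat hodgecm-mathlib-K2E1-p15 (g0), Track B ∕ K2-LIT «5Res (b) BL-2(χ,τ)», h413 =
`stmt-HodgeConjecture-24833`, line `K2_E1_TraceFormulaBeta`, route of record `HCCMUnconditional`; offer (b) on the K2 bus 2026-09-04T11:24Z (R34, own block): the `(χ, τ)`
twin `hL2χ` of ★ `K2E1BLHomogeneousL2U2` — the `L²`-letter behind row 12b's `hunq` (★ p859726 `K2E1ChiEisensteinMeromorphicBallU2`), flagged by K2-defs1 (g6) 2026-09-04T11:09Z.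
-/
import Summits.HodgeConjecture.HodgeConjecture.Theorems.K2E1BLHomogeneousL2U2   -- ★ (K2E1-p02): `coeFn_deltaShift_iota_of_apply_eq_smul`, `ae_restrict_norm_comp_pZX_le`, `memLp_two_of_ae_norm_comp_pZX_le_cm` (+ ★ leaves, ShiftBound, K2, P2a-A)
import HarnessLib

/-!
# K2·E1 — `K2E1ChiHomogeneousL2U2`: A HOMOGENEOUS SOLUTION OF THE `(χ, τ)` `𝔛`-SYSTEM IS IN `L²(G(F)∖G(𝔸), μ)` — the `(χ,τ)` twin `hL2χ` of ★ `K2E1BLHomogeneousL2U2` (constant term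
# `L z b′ = Σ_j b′_j·[f_{1−z}^{φ′_j}]` in place of `b′·[H^{1−z}]`), and the payment of the essential bound of `δ(h)` on bounded multiples of `HZ^w`

Track B ∕ K2-LIT, crux h413 = `stmt-HodgeConjecture-24833`; cell `hodgecm-mathlib`, squad K2, ENGINE E1, campaign «5Res», road «BL-2(χ,τ) ∘ MS-2(χ,τ) ∘ ARCH-UNITARITY ∘ R8₂»
(SHEET rows 11–13).  THEOREMS ONLY (no `def`, no `instance`, no notation, no named-fact hypothesis, no `sorry`); lane `--kind proof --supports stmt-HodgeConjecture-24833 --as helper`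
(count-neutral).  Closes no socket.

WHAT CHANGES WITH `(χ, τ)` ([BernsteinLapid2019, §4 Claim 2 (p. 9), Claim 5 (p. 10)]).  In the spherical file a homogeneous solution `ψ` of the one-ball `𝔛`-system has constant term
`cnstN(ιψ) = b′•α₂(z)`, `α₂(z) = [H^{1−z}]`, and the a.e. identity `λ·ιψ = R(h)f₀ + b′·δ(α₂)` on `Z_{a₀}` bounds `ιψ` from K2's cusp decay `hK1` and the essential bound of `δ(α₂)`
(paid from `α₂ =ᵐ HZ^{1−z}`, `Re(1−z) < 0`).  For a cuspidal datum `(χ, τ)` the constant term of a homogeneous solution is `cnstN(ιψ) = L z b′` with `L z b′ = Σ_j b′_j • α₂ j z`,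
`α₂ j z = [f_{1−z}^{φ′_j}]`, `φ′_j` bounded `χʷ`-sections (row 11b ★ `K2E1BLXSystemPackageFinDimU`, row 12b ★ p859726): §1 runs the a.e. algebra with an ARBITRARY constant-term vector
`β` (`cnstN(ιψ) = β`, letter: `δ(β)` essentially bounded on `Z_{a₀}`), §2 PAYS that letter for `β = Σ_j b_j • α_j` from per-column bounds and for a column `α =ᵐ ψ̃·HZ^w` with `ψ̃`
BOUNDED on `Z` and `Re w ≤ 0` (`|R(h)(ψ̃HZ^w)(x)| ≤ M·a^{Re w}·‖h‖₁` for `x ∈ Z_{a₀}`), §3 is the ★ transfer `Z → 𝔛` by name, §4 the heads in the `hL2` slot shape of the `(χ,τ)`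
uniqueness head (companion `K2E1ChiUniquenessHunqCMTwo.hunq_of_memLp_two_finDim`): `… → cnstN(ιψ) = L z b′ → Q ψ = 0 → MemLp ψ 2 μ`.

* §1 (rank `N`) `ae_eq_rightConvFun_add_of_homogeneous_vec` (`λ·ιψ =ᵐ R(h)f₀ + δ(β)`), `ae_norm_iota_le_of_homogeneous_vec`, **`exists_ae_norm_iota_le_of_homogeneous_vec`**.
* §2 (rank `N`) **`exists_ae_norm_deltaShift_le_of_ae_eq_mul_cpow`** (column payment, bounded factor), **`exists_ae_norm_deltaShift_sum_smul_le`** (finite sums of columns).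
* §4 HEADS **`hL2_chi_of_lt`** (rank `N`, transfer letter `htr`) and **`hL2_chi_cm_two`** (CM pair, `N = 2`, `σ₀ = 1`, transfer ★ `memLp_two_of_ae_norm_comp_pZX_le_cm`).

HONEST LABEL: HC_CM is proved only modulo the 7 printed citations (2 remaining named inputs: hLiu418 = `stmt-HodgeConjecture-24832`, h413 = `stmt-HodgeConjecture-24833`) until rung 0
closes; this file asserts no named fact and closes no socket.  Remaining letters of the heads: K2's `hK1` at `i₀` (★ `hK1_cm_two_of`, K2E1-p11), P3-C's `hδι` (★ `deltaShift_comp_iota`),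
`hδL` (§2 here, per column from `α₂ j z =ᵐ zFun φ′_j · HZ^{1−z}`).

## References
* [BernsteinLapid2019] J. Bernstein, E. Lapid, *On the meromorphic continuation of Eisenstein series*, J. AMS 37 (2024) (arXiv:1911.02342), §4 Claims 2, 4, 5 (pp. 9–10).
* [MoeglinWaldspurger1995] C. Mœglin, J.-L. Waldspurger, *Spectral Decomposition and Eisenstein Series* (1995), I.2.12–I.2.13, I.4.10.
* [Folland1999] G. B. Folland, *Real Analysis*, 2nd ed. (1999), Thm. 2.37, Prop. 2.23.
-/

set_option autoImplicit false
set_option linter.dupNamespace false  -- the mandated namespace repeats the summit's segment (`HodgeConjecture.HodgeConjecture`)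

noncomputable section

open MeasureTheory MeasureTheory.Measure Set NumberField IsDedekindDomain Filter Topology Metric
open scoped NNReal ENNReal
open Literature.MeasureTheory.Group Literature.NumberTheory.Automorphic Literature.NumberTheory.Automorphic.UnitaryGroup AdelicGroupData
open Summit.HodgeConjecture.HodgeConjecture.Cruxes.H413.K2E1BLBorelSpacesU2Defs
open Summit.HodgeConjecture.HodgeConjecture.Cruxes.H413.K2E1BLBorelOperatorsU2Defs
open Summit.HodgeConjecture.HodgeConjecture.Cruxes.H413.K2E1BLSpacesU2 (sub_cnstN_mem_HNcusp)
open Summit.HodgeConjecture.HodgeConjecture.Cruxes.H413.K2E1BLShiftBoundU2 (ae_weightedTruncMeasure_iff)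
open Summit.HodgeConjecture.HodgeConjecture.Cruxes.H413.K2E1BLRightConvTonelliU2 (rightConvFun_congr_ae_restrict borelQuotHeight_pos)
open Summit.HodgeConjecture.HodgeConjecture.Cruxes.H413.K2E1TruncatedCuspCompactU2 (ae_lt_borelQuotHeight_weightedTruncMeasure measurableSet_lt_borelQuotHeight)
open Summit.HodgeConjecture.HodgeConjecture.Cruxes.H413.K2E1BLHomogeneousL2U2 (coeFn_deltaShift_iota_of_apply_eq_smul ae_restrict_norm_comp_pZX_le memLp_two_of_ae_norm_comp_pZX_le_cm)

namespace Summit.HodgeConjecture.HodgeConjecture.Cruxes.H413.K2E1ChiHomogeneousL2U2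

/-! ## §1 The a.e. algebra on `Z_{a₀}` with an arbitrary constant-term vector `β`: `λ·ιψ = R(h)f₀ + δ(β)` -/

section Generic

variable {F E : Type} [Field F] [NumberField F] [Field E] [NumberField E] [Algebra F E] {c : E ≃ₐ[F] E} {N : ℕ} [NeZero N]
  [MeasurableSpace (quasiSplit F E c N).Adelic]
  {k : ℕ} {a a₀ : ℝ≥0} {μ : Measure (quasiSplit F E c N).automorphicQuotient} {μZ : Measure (borelQuotient F E c N)}
  {νG : Measure (quasiSplit F E c N).Adelic} {h : (quasiSplit F E c N).Adelic → ℂ}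

/-- **THE IDENTITY `λ·ιψ = R(h)f₀ + δ(β)` a.e. on `Z_{a₀}`**, `f₀ = ιψ − cnstN(ιψ)`, for a homogeneous solution with an ARBITRARY constant-term vector (`T ψ = λ•ψ`, `cnstN(ιψ) = β`):
★ `coeFn_deltaShift_iota_of_apply_eq_smul` and ★ `deltaShift_spec` (`δ f =ᵐ R(h) f`).  The spherical `β = b′•α₂` is ★ `ae_eq_rightConvFun_add_of_homogeneous`.
[cite: BernsteinLapid2019, §4 Claim 2 (p. 9) and Claim 5 (p. 10)] -/
theorem ae_eq_rightConvFun_add_of_homogeneous_vec (haa₀ : a ≤ a₀) (hb : IotaBound F E c N k a μ μZ) (hs : ShiftBound F E c N k a a₀ νG μZ h)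
    {T : HX F E c N k μ →L[ℂ] HX F E c N k μ} (hδι : deltaShift hs ∘L iota hb = restrHN F E c N k haa₀ μZ ∘L iota hb ∘L T)
    {ψ : HX F E c N k μ} {lam : ℂ} (hTψ : T ψ = lam • ψ) {β : HN F E c N k a μZ} (hP : cnstN F E c N k a μZ (iota hb ψ) = β) :
    (fun x => lam * (iota hb ψ : borelQuotient F E c N → ℂ) x) =ᵐ[weightedTruncMeasure F E c N k a₀ μZ]
      fun x => rightConvFun F E c N νG h ((iota hb ψ - cnstN F E c N k a μZ (iota hb ψ) : HN F E c N k a μZ) : borelQuotient F E c N → ℂ) x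
        + (deltaShift hs β : borelQuotient F E c N → ℂ) x := by
  have h1 : deltaShift hs (iota hb ψ - cnstN F E c N k a μZ (iota hb ψ)) = deltaShift hs (iota hb ψ) - deltaShift hs β := by
    rw [map_sub, hP]
  filter_upwards [coeFn_deltaShift_iota_of_apply_eq_smul haa₀ hb hs hδι hTψ, deltaShift_spec hs (iota hb ψ - cnstN F E c N k a μZ (iota hb ψ)),
    Lp.coeFn_sub (deltaShift hs (iota hb ψ)) (deltaShift hs β)] with x hx h2 h3
  rw [h1, h3, Pi.sub_apply, hx] at h2
  rw [← h2]; ring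

/-- **THE ESSENTIAL BOUND ON `ιψ`** with K2's cusp-decay letter `hK1` (★ P8 §2's bytes) applied to `f₀ = ιψ − cnstN(ιψ)` (★ `sub_cnstN_mem_HNcusp`) and `λ ≠ 0`: a.e. on `Z_{a₀}`,
`‖ιψ(x)‖ ≤ |λ|⁻¹·(C‖f₀‖·HZ(x)^{−m} + ‖δ(β)(x)‖)`. [cite: BernsteinLapid2019, §4 Claim 2 (p. 9) and Claim 5 (p. 10)] [cite: MoeglinWaldspurger1995, I.2.12] -/
theorem ae_norm_iota_le_of_homogeneous_vec (haa₀ : a ≤ a₀) (hb : IotaBound F E c N k a μ μZ) (hs : ShiftBound F E c N k a a₀ νG μZ h)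
    {T : HX F E c N k μ →L[ℂ] HX F E c N k μ} (hδι : deltaShift hs ∘L iota hb = restrHN F E c N k haa₀ μZ ∘L iota hb ∘L T)
    {ψ : HX F E c N k μ} {lam : ℂ} (hTψ : T ψ = lam • ψ) (hlam : lam ≠ 0) {β : HN F E c N k a μZ} (hP : cnstN F E c N k a μZ (iota hb ψ) = β)
    {C m : ℝ} (hK1 : ∀ f : HNcusp F E c N k a μZ, ∀ᵐ x ∂(weightedTruncMeasure F E c N k a₀ μZ),
      ‖rightConvFun F E c N νG h ((f : HN F E c N k a μZ) : borelQuotient F E c N → ℂ) x‖ ≤ C * ‖f‖ * ((borelQuotHeight F E c N x : ℝ)) ^ (-m)) :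
    ∀ᵐ x ∂(weightedTruncMeasure F E c N k a₀ μZ), ‖(iota hb ψ : borelQuotient F E c N → ℂ) x‖ ≤
      ‖lam‖⁻¹ * (C * ‖iota hb ψ - cnstN F E c N k a μZ (iota hb ψ)‖ * ((borelQuotHeight F E c N x : ℝ)) ^ (-m)
        + ‖(deltaShift hs β : borelQuotient F E c N → ℂ) x‖) := by
  have hf₀ := hK1 ⟨iota hb ψ - cnstN F E c N k a μZ (iota hb ψ), sub_cnstN_mem_HNcusp (iota hb ψ)⟩
  have hpos : 0 < ‖lam‖ := norm_pos_iff.2 hlam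
  filter_upwards [ae_eq_rightConvFun_add_of_homogeneous_vec haa₀ hb hs hδι hTψ hP, hf₀] with x hx hKx
  rw [le_inv_mul_iff₀ hpos, ← norm_mul, hx]
  exact (norm_add_le _ _).trans (add_le_add hKx le_rfl)

/-- **UNIFORM ESSENTIAL BOUND**: if moreover `C, m ≥ 0`, `a₀ > 0` and `δ(β)` is essentially bounded on `Z_{a₀}` (letter `hδβ`, §2), then `‖ιψ‖ ≤ M` a.e. on `Z_{a₀}` (`HZ > a₀` a.e., ★
`ae_lt_borelQuotHeight_weightedTruncMeasure`, so `HZ^{−m} ≤ a₀^{−m}`). [cite: BernsteinLapid2019, §4 Claim 2 (p. 9)] -/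
theorem exists_ae_norm_iota_le_of_homogeneous_vec (ha₀ : 0 < a₀) (haa₀ : a ≤ a₀) (hb : IotaBound F E c N k a μ μZ) (hs : ShiftBound F E c N k a a₀ νG μZ h)
    {T : HX F E c N k μ →L[ℂ] HX F E c N k μ} (hδι : deltaShift hs ∘L iota hb = restrHN F E c N k haa₀ μZ ∘L iota hb ∘L T)
    {ψ : HX F E c N k μ} {lam : ℂ} (hTψ : T ψ = lam • ψ) (hlam : lam ≠ 0) {β : HN F E c N k a μZ} (hP : cnstN F E c N k a μZ (iota hb ψ) = β)
    {C m : ℝ} (hC : 0 ≤ C) (hm : 0 ≤ m) (hK1 : ∀ f : HNcusp F E c N k a μZ, ∀ᵐ x ∂(weightedTruncMeasure F E c N k a₀ μZ),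
      ‖rightConvFun F E c N νG h ((f : HN F E c N k a μZ) : borelQuotient F E c N → ℂ) x‖ ≤ C * ‖f‖ * ((borelQuotHeight F E c N x : ℝ)) ^ (-m))
    {M₁ : ℝ} (hδβ : ∀ᵐ x ∂(weightedTruncMeasure F E c N k a₀ μZ), ‖(deltaShift hs β : borelQuotient F E c N → ℂ) x‖ ≤ M₁) :
    ∃ M : ℝ, ∀ᵐ x ∂(weightedTruncMeasure F E c N k a₀ μZ), ‖(iota hb ψ : borelQuotient F E c N → ℂ) x‖ ≤ M := by
  refine ⟨‖lam‖⁻¹ * (C * ‖iota hb ψ - cnstN F E c N k a μZ (iota hb ψ)‖ * ((a₀ : ℝ)) ^ (-m) + M₁), ?_⟩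
  filter_upwards [ae_norm_iota_le_of_homogeneous_vec haa₀ hb hs hδι hTψ hlam hP hK1, hδβ, ae_lt_borelQuotHeight_weightedTruncMeasure k a₀ μZ] with x hx hδx hHx
  refine hx.trans (mul_le_mul_of_nonneg_left (add_le_add ?_ hδx) (inv_nonneg.2 (norm_nonneg _)))
  exact mul_le_mul_of_nonneg_left (Real.rpow_le_rpow_of_nonpos (NNReal.coe_pos.2 ha₀) (NNReal.coe_le_coe.2 hHx.le) (neg_nonpos.2 hm))
    (mul_nonneg hC (norm_nonneg _))

/-! ## §2 PAYMENT of the letter `hδβ`: finite sums of columns, and a column `α =ᵐ ψ̃·HZ^w` with `ψ̃` bounded, `Re w ≤ 0` -/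

/-- **FINITE SUMS OF ESSENTIALLY BOUNDED COLUMNS**: if `‖δ(α_j)‖ ≤ M_j` a.e. on `Z_{a₀}` for each `j`, then `δ(Σ_{j ∈ s} b_j • α_j)` is essentially bounded on `Z_{a₀}` for every finite `s`
(`δ` is linear; induction on `s` with ★ `Lp.coeFn_add`∕`coeFn_smul`).  With `s = univ` this is the letter `hδL` for `L z b = Σ_j b_j • α₂ j z` (★ 11b `sum_proj_smulRight_apply`). [folklore] -/
theorem exists_ae_norm_deltaShift_sum_smul_le {ι : Type*} (s : Finset ι) (hs : ShiftBound F E c N k a a₀ νG μZ h) (α : ι → HN F E c N k a μZ)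
    (hδα : ∀ j, ∃ M : ℝ, ∀ᵐ x ∂(weightedTruncMeasure F E c N k a₀ μZ), ‖(deltaShift hs (α j) : borelQuotient F E c N → ℂ) x‖ ≤ M) (b : ι → ℂ) :
    ∃ M : ℝ, ∀ᵐ x ∂(weightedTruncMeasure F E c N k a₀ μZ), ‖(deltaShift hs (∑ j ∈ s, b j • α j) : borelQuotient F E c N → ℂ) x‖ ≤ M := by
  classical
  induction s using Finset.induction_on with
  | empty =>
    refine ⟨0, ?_⟩
    rw [Finset.sum_empty, map_zero]
    filter_upwards [Lp.coeFn_zero ℂ 2 (weightedTruncMeasure F E c N k a₀ μZ)] with x hx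
    rw [hx, Pi.zero_apply, norm_zero]
  | insert j s hj ih =>
    obtain ⟨M, hM⟩ := ih
    obtain ⟨Mj, hMj⟩ := hδα j
    refine ⟨‖b j‖ * Mj + M, ?_⟩
    rw [Finset.sum_insert hj, map_add, map_smul]
    filter_upwards [hM, hMj, Lp.coeFn_add (b j • deltaShift hs (α j)) (deltaShift hs (∑ i ∈ s, b i • α i)), Lp.coeFn_smul (b j) (deltaShift hs (α j))]
      with x hx hxj hadd hsm
    rw [hadd, Pi.add_apply, hsm, Pi.smul_apply]
    refine (norm_add_le _ _).trans (add_le_add ?_ hx)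
    rw [norm_smul]
    exact mul_le_mul_of_nonneg_left hxj (norm_nonneg _)

variable [BorelSpace (quasiSplit F E c N).Adelic]

/-- **`δ(α)` IS ESSENTIALLY BOUNDED ON `Z_{a₀}`** for a column `α =ᵐ ψ̃·HZ^w` on `Z_a` with `ψ̃` BOUNDED (`‖ψ̃‖ ≤ M`) and `Re w ≤ 0` — the `(χ,τ)` twin of ★ `exists_ae_norm_deltaShift_le_of_ae_eq_cpow`
(`ψ̃ = zFun φ′` for a bounded `χʷ`-section `φ′`, `w = 1 − z`): `δ(α) =ᵐ R(h)α =ᵐ R(h)(ψ̃·HZ^w)` (★ `deltaShift_spec`, ★ `rightConvFun_congr_ae_restrict` with the right-shift data of the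
`ShiftBound` discharge), and for `x ∈ Z_{a₀}`, `y ∈ Ω`: `HZ(x·y) > a` so `|ψ̃(x·y)·HZ(x·y)^w| ≤ M·a^{Re w}`, whence `|R(h)(ψ̃HZ^w)(x)| ≤ M·a^{Re w}·‖h‖₁`.
[cite: BernsteinLapid2019, §4 p. 10] [cite: Folland1999, Thm. 2.37] -/
theorem exists_ae_norm_deltaShift_le_of_ae_eq_mul_cpow [SFinite νG] [SFinite μZ] (hright : ∀ y, MeasurePreserving (rightShift F E c N y) μZ μZ)
    {Ω : Set (quasiSplit F E c N).Adelic} (hΩm : MeasurableSet Ω) {κ : ℝ≥0} (hκ : 0 < κ) (hc : κ * a ≤ a₀)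
    (hΩ : ∀ z : borelQuotient F E c N, ∀ y ∈ Ω, borelQuotHeight F E c N z ≤ κ * borelQuotHeight F E c N (rightShift F E c N y z))
    (hsupp : ∀ y, y ∉ Ω → h y = 0) (hh : Integrable h νG) (hs : ShiftBound F E c N k a a₀ νG μZ h) (ha : 0 < a)
    {ψt : borelQuotient F E c N → ℂ} {M : ℝ} (hψt : ∀ x, ‖ψt x‖ ≤ M)
    {α : HN F E c N k a μZ} {w : ℂ}
    (hα : (α : borelQuotient F E c N → ℂ) =ᵐ[weightedTruncMeasure F E c N k a μZ] fun x => ψt x * (((borelQuotHeight F E c N x : ℝ≥0) : ℝ) : ℂ) ^ w) (hw : w.re ≤ 0) :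
    ∃ M' : ℝ, ∀ᵐ x ∂(weightedTruncMeasure F E c N k a₀ μZ), ‖(deltaShift hs α : borelQuotient F E c N → ℂ) x‖ ≤ M' := by
  refine ⟨M * ((a : ℝ)) ^ w.re * ∫ y, ‖h y‖ ∂νG, ?_⟩
  have hα' : (α : borelQuotient F E c N → ℂ) =ᵐ[μZ.restrict {z | a < borelQuotHeight F E c N z}]
      fun x => ψt x * (((borelQuotHeight F E c N x : ℝ≥0) : ℝ) : ℂ) ^ w := (ae_weightedTruncMeasure_iff μZ k a).1 hα
  have hR := rightConvFun_congr_ae_restrict νG μZ hright hΩm hκ hc hΩ hsupp hα'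
  rw [ae_weightedTruncMeasure_iff μZ k a₀]
  filter_upwards [(ae_weightedTruncMeasure_iff μZ k a₀).1 (deltaShift_spec hs α), hR, ae_restrict_mem (measurableSet_lt_borelQuotHeight a₀)] with x hδx hRx hx₀
  rw [hδx, hRx]
  have hx₀' : a₀ < borelQuotHeight F E c N x := hx₀
  have hbound : ∀ y, ‖h y * (ψt (rightShift F E c N y x) * (((borelQuotHeight F E c N (rightShift F E c N y x) : ℝ≥0) : ℝ) : ℂ) ^ w)‖ ≤ M * ((a : ℝ)) ^ w.re * ‖h y‖ := by
    intro y
    by_cases hy : y ∈ Ω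
    · have haH : a < borelQuotHeight F E c N (rightShift F E c N y x) := lt_of_mul_lt_mul_left ((hc.trans_lt hx₀').trans_le (hΩ x y hy)) hκ.le
      rw [norm_mul, norm_mul, Complex.norm_cpow_eq_rpow_re_of_pos (NNReal.coe_pos.2 (borelQuotHeight_pos _)), mul_comm]
      refine mul_le_mul_of_nonneg_right (mul_le_mul (hψt _) ?_ (Real.rpow_nonneg (NNReal.coe_nonneg _) _) ((norm_nonneg (ψt (rightShift F E c N y x))).trans (hψt _))) (norm_nonneg _)
      exact Real.rpow_le_rpow_of_nonpos (NNReal.coe_pos.2 ha) (NNReal.coe_le_coe.2 haH.le) hw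
    · have h0 : (0 : ℝ) ≤ M * ((a : ℝ)) ^ w.re * ‖h y‖ := by
        rw [hsupp y hy, norm_zero, mul_zero]
      simpa only [hsupp y hy, zero_mul, norm_zero] using h0
  calc ‖rightConvFun F E c N νG h (fun x => ψt x * (((borelQuotHeight F E c N x : ℝ≥0) : ℝ) : ℂ) ^ w) x‖
      ≤ ∫ y, M * ((a : ℝ)) ^ w.re * ‖h y‖ ∂νG := norm_integral_le_of_norm_le (hh.norm.const_mul _) (Eventually.of_forall hbound)
    _ = M * ((a : ℝ)) ^ w.re * ∫ y, ‖h y‖ ∂νG := integral_const_mul _ _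

/-! ## §4a THE RANK-GENERIC HEAD: the letter `hL2` of the `(χ,τ)` uniqueness head, on the transfer letter `htr` -/

omit [BorelSpace (quasiSplit F E c N).Adelic] in
/-- **A HOMOGENEOUS `(χ, τ)` SOLUTION AT A POINT OF `U₀` IS IN `L²(μ)`, RANK-GENERIC** — the `hL2` slot of `K2E1ChiUniquenessHunqCMTwo.hunq_of_memLp_of_lt_finDim` BYTE-FOR-BYTE
(`ι := iota hb`, `P := cnstN k a μZ`, constant term `L z b′`).  Data as ★ `hL2_of_lt` with the vector `α₂` replaced by the finite-dimensional family `L : ℂ → B →L 𝓗_k(Z_a)` and the letter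
`hδL`: `δ(L z b′)` essentially bounded on `Z_{a₀}` for every `b′` (§2 pays it columnwise); transfer letter `htr` (§3 ★ pays it for the CM pair at `N = 2`).  THEN for `z ∈ ball 0 (n+2)`,
`σ₀ < Re z`, `Im ĥ_{i₀}(z) ≠ 0`, every `ψ` with `T i ψ = ĥ_i(z)•ψ` (all `i`), `cnstN(ιψ) = L z b′`, `Q ψ = 0` is in `L²(μ)`. [cite: BernsteinLapid2019, §4 Claim 2 (p. 9), Claim 5 (p. 10)]
[cite: MoeglinWaldspurger1995, I.4.10] -/
theorem hL2_chi_of_lt (σ₀ : ℝ) (n : ℕ) {I : Type*} (i₀ : I) {hI : I → (quasiSplit F E c N).Adelic → ℂ}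
    (ha₀ : 0 < a₀) (haa₀ : a ≤ a₀) (hb : IotaBound F E c N k a μ μZ) (hs : ShiftBound F E c N k a a₀ νG μZ (hI i₀))
    (T : I → HX F E c N k μ →L[ℂ] HX F E c N k μ) (hδι : deltaShift hs ∘L iota hb = restrHN F E c N k haa₀ μZ ∘L iota hb ∘L T i₀)
    {C m : ℝ} (hC : 0 ≤ C) (hm : 0 ≤ m)
    (hK1 : ∀ f : HNcusp F E c N k a μZ, ∀ᵐ x ∂(weightedTruncMeasure F E c N k a₀ μZ),
      ‖rightConvFun F E c N νG (hI i₀) ((f : HN F E c N k a μZ) : borelQuotient F E c N → ℂ) x‖ ≤ C * ‖f‖ * ((borelQuotHeight F E c N x : ℝ)) ^ (-m))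
    {B : Type*} [NormedAddCommGroup B] [NormedSpace ℂ B] (L : ℂ → B →L[ℂ] HN F E c N k a μZ)
    (hδL : ∀ z ∈ ball (0 : ℂ) (n + 2), σ₀ < z.re → ∀ b' : B,
      ∃ M : ℝ, ∀ᵐ x ∂(weightedTruncMeasure F E c N k a₀ μZ), ‖(deltaShift hs (L z b') : borelQuotient F E c N → ℂ) x‖ ≤ M)
    (htr : ∀ (ψ : HX F E c N k μ) (M : ℝ), (∀ᵐ x ∂(μZ.restrict {x | a₀ < borelQuotHeight F E c N x}),
      ‖(ψ : (quasiSplit F E c N).automorphicQuotient → ℂ) (pZX F E c N x)‖ ≤ M) → MemLp (ψ : (quasiSplit F E c N).automorphicQuotient → ℂ) 2 μ)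
    {X' : Type*} [NormedAddCommGroup X'] [NormedSpace ℂ X'] (Q : HX F E c N k μ →L[ℂ] X') :
    ∀ z ∈ ball (0 : ℂ) (n + 2), σ₀ < z.re → (∫ x, hI i₀ x * (((borelHeight x : ℝ≥0) : ℝ) : ℂ) ^ z ∂νG).im ≠ 0 →
      ∀ (ψ : HX F E c N k μ) (b' : B), (∀ i, T i ψ = (∫ x, hI i x * (((borelHeight x : ℝ≥0) : ℝ) : ℂ) ^ z ∂νG) • ψ) →
        cnstN F E c N k a μZ (iota hb ψ) = L z b' → Q ψ = 0 → MemLp (ψ : (quasiSplit F E c N).automorphicQuotient → ℂ) 2 μ := by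
  intro z hzb hzσ hzim ψ b' hTψ hP _
  obtain ⟨M₁, hM₁⟩ := hδL z hzb hzσ b'
  have hlam : (∫ x, hI i₀ x * (((borelHeight x : ℝ≥0) : ℝ) : ℂ) ^ z ∂νG) ≠ 0 := fun h0 => hzim (by rw [h0, Complex.zero_im])
  obtain ⟨M, hM⟩ := exists_ae_norm_iota_le_of_homogeneous_vec ha₀ haa₀ hb hs hδι (hTψ i₀) hlam hP hC hm hK1 hM₁
  exact htr ψ M (ae_restrict_norm_comp_pZX_le haa₀ hb hM)

end Generic

/-! ## §4b THE CM HEAD (`N = 2`, `σ₀ = 1`): the letter `hL2` of the `(χ,τ)` uniqueness head, transfer discharged -/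

section CM

variable (L : Type) [Field L] [NumberField L] [IsCMField L]
  [MeasurableSpace (quasiSplit (↥(maximalRealSubfield L)) L (IsCMField.complexConj L) 2).Adelic]
  [BorelSpace (quasiSplit (↥(maximalRealSubfield L)) L (IsCMField.complexConj L) 2).Adelic]

/-- **A HOMOGENEOUS `(χ, τ)` SOLUTION IS IN `L²(μ)` FOR THE CM PAIR AT `N = 2`** — the `hL2` slot of `K2E1ChiUniquenessHunqCMTwo.hunq_of_memLp_two_finDim` BYTE-FOR-BYTE (`ι := iota hb`,
`P := cnstN k a μZ`, constant term `Lz z b′`), with the transfer discharged by ★ `memLp_two_of_ae_norm_comp_pZX_le_cm` (P2a-ι comparison frame `(L μ νG hβ hμZ)`).  Remaining letters: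
K2's `hK1` for `h i₀` (★ `hK1_cm_two_of`), P3-C's `hδι` (★ `deltaShift_comp_iota`), and `hδL` (§2: columnwise from `α₂ j z =ᵐ zFun φ′_j · HZ^{1−z}`, `Re(1 − z) < 0` on the Godement set).
[cite: BernsteinLapid2019, §4 Claim 2 (p. 9), Claims 4–5 (p. 10)] [cite: MoeglinWaldspurger1995, I.4.10] -/
theorem hL2_chi_cm_two
    (μ : Measure (quasiSplit (↥(maximalRealSubfield L)) L (IsCMField.complexConj L) 2).automorphicQuotient)
    [(quasiSplit (↥(maximalRealSubfield L)) L (IsCMField.complexConj L) 2).IsAutomorphicMeasure μ]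
    (νG : Measure (quasiSplit (↥(maximalRealSubfield L)) L (IsCMField.complexConj L) 2).Adelic) [νG.IsHaarMeasure] [νG.IsInvInvariant]
    {β : (quasiSplit (↥(maximalRealSubfield L)) L (IsCMField.complexConj L) 2).Adelic → ℝ≥0∞}
    (hβ : IsCoveringWeight ↥((arithmeticBorel (↥(maximalRealSubfield L)) L (IsCMField.complexConj L) 2).map
      (quasiSplit (↥(maximalRealSubfield L)) L (IsCMField.complexConj L) 2).arithmeticSubgroup.subtype) β)
    {μZ : Measure (borelQuotient (↥(maximalRealSubfield L)) L (IsCMField.complexConj L) 2)}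
    (hμZ : ∀ f : borelQuotient (↥(maximalRealSubfield L)) L (IsCMField.complexConj L) 2 → ℝ≥0∞, Measurable f →
      ∫⁻ z, f z ∂μZ = ∫⁻ g, β g * f (toBorelQuotient (↥(maximalRealSubfield L)) L (IsCMField.complexConj L) 2 g) ∂νG)
    (k n : ℕ) {I : Type*} (i₀ : I) {h : I → (quasiSplit (↥(maximalRealSubfield L)) L (IsCMField.complexConj L) 2).Adelic → ℂ}
    {a a₀ : ℝ≥0} (ha₀ : 0 < a₀) (haa₀ : a ≤ a₀) (hfin : μZ {z | a < borelQuotHeight (↥(maximalRealSubfield L)) L (IsCMField.complexConj L) 2 z} ≠ ∞)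
    (hb : IotaBound (↥(maximalRealSubfield L)) L (IsCMField.complexConj L) 2 k a μ μZ)
    (hs : ShiftBound (↥(maximalRealSubfield L)) L (IsCMField.complexConj L) 2 k a a₀ νG μZ (h i₀))
    (T : I → HX (↥(maximalRealSubfield L)) L (IsCMField.complexConj L) 2 k μ →L[ℂ] HX (↥(maximalRealSubfield L)) L (IsCMField.complexConj L) 2 k μ)
    (hδι : deltaShift hs ∘L iota hb = restrHN (↥(maximalRealSubfield L)) L (IsCMField.complexConj L) 2 k haa₀ μZ ∘L iota hb ∘L T i₀)
    {C m : ℝ} (hC : 0 ≤ C) (hm : 0 ≤ m)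
    (hK1 : ∀ f : HNcusp (↥(maximalRealSubfield L)) L (IsCMField.complexConj L) 2 k a μZ,
      ∀ᵐ x ∂(weightedTruncMeasure (↥(maximalRealSubfield L)) L (IsCMField.complexConj L) 2 k a₀ μZ),
        ‖rightConvFun (↥(maximalRealSubfield L)) L (IsCMField.complexConj L) 2 νG (h i₀)
            ((f : HN (↥(maximalRealSubfield L)) L (IsCMField.complexConj L) 2 k a μZ) : borelQuotient (↥(maximalRealSubfield L)) L (IsCMField.complexConj L) 2 → ℂ) x‖ ≤
          C * ‖f‖ * ((borelQuotHeight (↥(maximalRealSubfield L)) L (IsCMField.complexConj L) 2 x : ℝ)) ^ (-m))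
    {B : Type*} [NormedAddCommGroup B] [NormedSpace ℂ B] (Lz : ℂ → B →L[ℂ] HN (↥(maximalRealSubfield L)) L (IsCMField.complexConj L) 2 k a μZ)
    (hδL : ∀ z ∈ ball (0 : ℂ) (n + 2), 1 < z.re → ∀ b' : B, ∃ M : ℝ, ∀ᵐ x ∂(weightedTruncMeasure (↥(maximalRealSubfield L)) L (IsCMField.complexConj L) 2 k a₀ μZ),
      ‖(deltaShift hs (Lz z b') : borelQuotient (↥(maximalRealSubfield L)) L (IsCMField.complexConj L) 2 → ℂ) x‖ ≤ M)
    {X' : Type*} [NormedAddCommGroup X'] [NormedSpace ℂ X'] (Q : HX (↥(maximalRealSubfield L)) L (IsCMField.complexConj L) 2 k μ →L[ℂ] X') :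
    ∀ z ∈ ball (0 : ℂ) (n + 2), 1 < z.re → (∫ x, h i₀ x * (((borelHeight x : ℝ≥0) : ℝ) : ℂ) ^ z ∂νG).im ≠ 0 →
      ∀ (ψ : HX (↥(maximalRealSubfield L)) L (IsCMField.complexConj L) 2 k μ) (b' : B),
        (∀ i, T i ψ = (∫ x, h i x * (((borelHeight x : ℝ≥0) : ℝ) : ℂ) ^ z ∂νG) • ψ) →
          cnstN (↥(maximalRealSubfield L)) L (IsCMField.complexConj L) 2 k a μZ (iota hb ψ) = Lz z b' → Q ψ = 0 →
            MemLp (ψ : (quasiSplit (↥(maximalRealSubfield L)) L (IsCMField.complexConj L) 2).automorphicQuotient → ℂ) 2 μ :=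
  have hfin₀ : μZ {z | a₀ < borelQuotHeight (↥(maximalRealSubfield L)) L (IsCMField.complexConj L) 2 z} ≠ ∞ :=
    ((measure_mono fun _ hz => lt_of_le_of_lt haa₀ hz).trans_lt (lt_top_iff_ne_top.2 hfin)).ne
  hL2_chi_of_lt 1 n i₀ ha₀ haa₀ hb hs T hδι hC hm hK1 Lz hδL (fun ψ _ hM => memLp_two_of_ae_norm_comp_pZX_le_cm L μ νG hβ hμZ k ψ ha₀ hfin₀ hM) Q

end CM

end Summit.HodgeConjecture.HodgeConjecture.Cruxes.H413.K2E1ChiHomogeneousL2U2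

end
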